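import Summits.AtomisticToContinuum.HydrodynamicLimit.Theses.MourreKoopmanCharges
import Summits.AtomisticToContinuum.HydrodynamicLimit.Theorems.ImplosionDichotomyHydroLimitInBandOfHeart
import HarnessLib

/-!
# Route `MourreKoopmanCharges`, crux `LinearToEntropyInBand` (stmt-AtomisticToContinuum-17740): the guarded
# Grönwall core docks to the route's Yau target (registered bookkeeping stubs S1 `stub_dockGronwallCoreInBand`, S2 `stub_gronwallCoreOfLedger`)

Support file (`--supports stmt-AtomisticToContinuum-17740`) of the line `registered`, skeleton v3
(`Cruxes/LinearToEntropyInBand/Lines/birth.lean`, lead prover-line-…-17740-c3-0).  The crux is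
`OneBodyCompleteness → StressStrongMixing → <body of RelEntropyVanishingInBand>`; its consequent, the shared
GUARDED Yau target `MourreKoopmanCharges.RelEntropyVanishingInBand` (stmt-17396: probability of the initial local
Gibbs laws; for every `t ∈ [0,T)` an activity profile `a_t` whose local Gibbs law is a probability measure with
exponentially concentrating density / momentum / energy fields around `(ρ, ρu, E)(t)`; and
`klDiv(lawAt Φ_N (localGibbs a₀ u₀ θ₀) t ‖ localGibbs a_t u_t θ_t)/(N+1) → 0`), is — up to definitional unfolding
— the consequent of the landed reduction `EntropyClockDock.relEntropyVanishingInBand_of_gronwallCoreInBand`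
(Theorems/ImplosionDichotomyHydroLimitInBandCoreReduction.lean, line `IdeatorOneSketch` of crux 9133), whose
antecedent is the landed `Prop` `HydroLimitInBandOfHeart.GronwallCoreInBand` (Yau's relative-entropy estimate
along every handed-over reference activity, for classical solutions guarded at level `η_c`).  Hence the GUARDED
GRONWALL CORE implies this route's Yau target, with the probability clause (`isProbabilityMeasure_localGibbsLaw`,
`σ ≤ 1/2`), the `t = 0` slice, activity inversion in the cluster radius and the `η_U`-uniform exponential law of
large numbers of local Gibbs laws (`uniformLocalGibbsConcentration_proof`) ALL discharged by the tree: the line's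
ball-wise Gronwall stub (`stub_ballwiseGronwallVisibleInBand`) therefore owes only the KL estimate.

Reference: H.-T. Yau, Lett. Math. Phys. 22 (1991) §2 (relative entropy along an explicit local-equilibrium
reference).
-/

noncomputable section

namespace Summit.AtomisticToContinuum.HydrodynamicLimit.Theorems.LTEInBand

/-- **S1 — the guarded Grönwall core docks to the route's Yau target** (registered bookkeeping stub
`stub_dockGronwallCoreInBand` of crux stmt-AtomisticToContinuum-17740, skeleton v3):
`HydroLimitInBandOfHeart.GronwallCoreInBand → MourreKoopmanCharges.RelEntropyVanishingInBand`, by the landed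
reduction `EntropyClockDock.relEntropyVanishingInBand_of_gronwallCoreInBand` (both `Prop`s unfold to its
antecedent / consequent definitionally). [cite: Yau1991, §2] -/
theorem stub_dockGronwallCoreInBand : Summit.AtomisticToContinuum.HydrodynamicLimit.Theorems.HydroLimitInBandOfHeart.GronwallCoreInBand → Summit.AtomisticToContinuum.HydrodynamicLimit.Theses.MourreKoopmanCharges.RelEntropyVanishingInBand :=
  fun h =>
    Summit.AtomisticToContinuum.HydrodynamicLimit.Theorems.EntropyClockDock.relEntropyVanishingInBand_of_gronwallCoreInBand h

/-- **Corollary (PATH B of crux 9133, typed at this crux's consequent):** the route's Yau target follows from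
the shared one-window heart `OneWindowLedger` (landed: `HydroLimitInBandSplit.oneWindowLedger_holds`), the window
continuity `WindowContinuity` (landed, p118327) and the six conjecture-grade inputs `LineInputs` of line
`IdeatorOneSketch` — by `HydroLimitInBandOfHeart.gronwallCoreInBand_of_heart` and S1.  Recorded here because it
shows that the crux's consequent is reachable WITHOUT the two Mourre hypotheses (the bridge is over-determined
by the OneFlightGossipEngine chain); it is not this line's composition. [cite: Yau1991, §2] -/
theorem relEntropyVanishingInBand_of_heart
    (hW : Summit.AtomisticToContinuum.HydrodynamicLimit.Theorems.HydroLimitInBandOfHeart.OneWindowLedger)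
    (hC : Summit.AtomisticToContinuum.HydrodynamicLimit.Theorems.HydroLimitInBandOfHeart.WindowContinuity)
    (hI : Summit.AtomisticToContinuum.HydrodynamicLimit.Theorems.HydroLimitInBandOfHeart.LineInputs) :
    Summit.AtomisticToContinuum.HydrodynamicLimit.Theses.MourreKoopmanCharges.RelEntropyVanishingInBand :=
  stub_dockGronwallCoreInBand
    (Summit.AtomisticToContinuum.HydrodynamicLimit.Theorems.HydroLimitInBandOfHeart.gronwallCoreInBand_of_heart
      hW hC hI)

/-- **S2 — the integrated one-window entropy ledger gives the guarded Grönwall core** (registered bookkeeping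
stub `stub_gronwallCoreOfLedger` of crux stmt-AtomisticToContinuum-17740, skeleton v4):
`ClampedCurrentsDockFromWindows.LedgerIntegratedCoreInBand → HydroLimitInBandOfHeart.GronwallCoreInBand` is the
landed entropy-clock glue `HydroLimitInBandOfHeart.gronwallCoreInBand_of_ledger` (analytic insertion factor,
uniform local Gibbs concentration, reference identification, `H_N(0) = 0`, running-supremum Grönwall) fed with
the landed a-priori bound `EntropyClockDock.ledgerAprioriBound`; so the line's ball-wise stub owes only Yau's
INTEGRATED LEDGER `H_N(t') ≤ (N+1)ε + K ∫₀^{t'} sup H_N` along the explicit reference family. [cite: Yau1991, §2] -/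
theorem stub_gronwallCoreOfLedger : Summit.AtomisticToContinuum.HydrodynamicLimit.Theorems.ClampedCurrentsDockFromWindows.LedgerIntegratedCoreInBand → Summit.AtomisticToContinuum.HydrodynamicLimit.Theorems.HydroLimitInBandOfHeart.GronwallCoreInBand :=
  fun h =>
    Summit.AtomisticToContinuum.HydrodynamicLimit.Theorems.HydroLimitInBandOfHeart.gronwallCoreInBand_of_ledger
      Summit.AtomisticToContinuum.HydrodynamicLimit.Theorems.EntropyClockDock.ledgerAprioriBound h

/-- **The crux's consequent from the integrated ledger** (S2 then S1): every Yau-type architecture that delivers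
the one-window entropy ledger in band along the explicit reference family closes `RelEntropyVanishingInBand`.
[cite: Yau1991, §2] -/
theorem relEntropyVanishingInBand_of_ledger
    (h : Summit.AtomisticToContinuum.HydrodynamicLimit.Theorems.ClampedCurrentsDockFromWindows.LedgerIntegratedCoreInBand) :
    Summit.AtomisticToContinuum.HydrodynamicLimit.Theses.MourreKoopmanCharges.RelEntropyVanishingInBand :=
  stub_dockGronwallCoreInBand (stub_gronwallCoreOfLedger h)

end Summit.AtomisticToContinuum.HydrodynamicLimit.Theorems.LTEInBand

end
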